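import Summits.ResolutionOfSingularities.ResolutionOfSingularities.Theorems.FrobeniusLadderFInjectiveMacaulayficationTauFloorBXChartAlgebra
import Summits.ResolutionOfSingularities.ResolutionOfSingularities.Theorems.FrobeniusLadderFInjectiveMacaulayficationTauFloorOneNotFull
import HarnessLib

/-!
# (N2-X′) The prime `𝔮 = (x̄, t̄, w̄, z̄′)` of the `D(x̄)` chart `T₂` of `Bl_τ(P2d4B)`: `𝔮 = ker κ`, `height 𝔮 = 2`, `dim (T₂)_𝔮 = 2`, and ★★ `¬ FullCl 2 ((T₂)_𝔮)` —
# the F-clause FAILS for the system of parameters `(x̄, w̄)`; hence every point of `V(𝔮)` is a NON-FULL point (a 2-dimensional non-FULL locus on floor 1 of row #3)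
# (crux `FInjectiveMacaulayfication` stmt-ResolutionOfSingularities-15315, chain w45a; res-L1-w45a-plan-1 g19 RULING R19.6 (3) «(N2)(E) `tauFloor_P2d4B_not_full` first»;
# sequel of `…TauFloorBXChartAlgebra`; pattern = res-L1-w45a-stub-2's p615290 `…TauFloorOneNotFull` with a TWO-ε target; seat res-L1-w45a-stub-2 g8)

[OURS · L1 W4.5a] Support file (`--supports stmt-ResolutionOfSingularities-15315 --as helper`); replaces the role of NO printed item; NOT a statement of any
manuscript; def-free; UNCONDITIONAL. The local statements §1–§2 hold over ANY field `k`; the point-wise form §3 assumes `CharP k 2` (the clause transport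
`ClauseLocalizes.fiClause_of_specializes` is stated for stalks of characteristic `p`). AI-written (AI review is weaker than expert review).

SETTING (from `…TauFloorBXChartAlgebra`): `B₀ = k[x, y′, u′, w] = MvPolynomial (Fin 4) k`, `T₂ = B₀[t][z′] = AdjoinRoot h₂` over `AdjoinRoot h₁`, `h₁ = T² − xw`,
`h₂ = Z² + (xZ + (x(y′³+u′³) + t w²))` (= the `D(x̄)` chart of `Bl_τ X`, `X = P2d4B = V(z²+x²z+y³+u³+t⁵)`, `τ = (x̄, ȳ, ū, t̄², z̄)`, after `y = xy′, u = xu′, z = xz′,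
t² = xw`); `κ : T₂ → B₀` the kill map (`x, w ↦ 0` on `B₀`, `t̄, z̄′ ↦ 0`), a hypothesis with its three defining values (it exists: `TauFloorBXChartAlgebra.exists_killMap`).
* §1 ★ `ker_killMap_eq : ker κ = (x̄, t̄, w̄, z̄′)` (normal forms `a₀ + a₁t̄ + (b₀ + b₁t̄)z̄′`), `under_kerKillMap : ker κ ∩ B₀ = (x, w)`, ★★ `height_kerKillMap :
  height (ker κ) = 2` — INCOMPARABILITY (`≤`, `T₂ ⊇ B₀` finite: `FlatIntegralCM.height_le_height_under_of_isIntegral`) + GOING-DOWN (`≥`, `T₂ ⊇ B₀` free ⇒ flat: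
  Mathlib `Ideal.height_eq_height_add_of_liesOver_of_hasGoingDown`) over `height (x, w) = 2`; ★ `ringKrullDim_localization_kerKillMap : dim (T₂)_𝔮 = 2`.
* §2 ★★ `not_fullCl_localization_kerKillMap : ¬ FullCl 2 ((T₂)_𝔮)`: `s = (x̄, w̄)` is a system of parameters of the 2-dimensional local ring `(T₂)_𝔮`
  (`√(s) ∋ t̄, z̄′` by `t̄² = x̄w̄`, `z̄′² = −(x̄z̄′ + x̄(ȳ′³+ū′³) + t̄w̄²)`, so `√(s) = 𝔮(T₂)_𝔮`); `y = t̄z̄′` has `y² = x̄²·(−w̄(z̄′+ȳ′³+ū′³)) + w̄²·(−x̄t̄w̄) ∈ (x̄², w̄²)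
  = (s)^{[2]}`, but `y ∉ (s)`: the map `T₂ → F[ε₁][ε₂]` (`F = Frac B₀`; `x, w ↦ 0`, `y′, u′ ↦ y′, u′`, `t̄ ↦ ε₂`, `z̄′ ↦ ε₁` — legitimate by the UNIVERSAL PROPERTY
  `TauFloorBXChartAlgebra.exists_towerLift`: `ε₂² = 0 = 0·0`, `ε₁² + 0·ε₁ + (0 + ε₂·0²) = 0`) sends `T₂ ∖ 𝔮` to units (its `fst ∘ fst` is `Frac ∘ κ`), hence extends to
  `(T₂)_𝔮`, kills `(s)`, and maps `y ↦ ε₂ε₁ ≠ 0`. So clause 3 of `FullCl 2` fails at `e = 1`.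
* §3 ★★ `not_fullCl_stalk_of_mem` [`CharP k 2`]: `¬ FullCl 2 (𝒪_{Spec T₂, w})` at EVERY point `w ∈ V(x̄, t̄, w̄, z̄′)` (FULL generizes; the generic point `𝔮` is not FULL).
What this is NOT: the scheme-level identification of `Spec T₂` with the `D(x̄)` chart of `Bl_τ(P2d4B)` ((N2) sequel, stub-3's (Y-b) template) and the S′-level
assembly `tauFloor_P2d4B_not_full` are separate files. [cite: Matsumura1987, Thm. 9.3, Thm. 9.5, Thm. 13.5] [cite: Fedder1983, Prop. 1.7 (context)]
-/

-- single-problem summit: the doubled namespace component is forced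
set_option linter.dupNamespace false

noncomputable section

namespace Summit.ResolutionOfSingularities.ResolutionOfSingularities.Theorems.FInjectiveMacaulayfication.TauFloorBXChartNotFull

open MvPolynomial IsLocalization AlgebraicGeometry CategoryTheory
open Summit.ResolutionOfSingularities.ResolutionOfSingularities.Theorems.FInjectiveMacaulayfication
open SliceableCentre TauFloorBXChartAlgebra

variable (k : Type) [Field k]

/-! ## §1 The prime `𝔮 = ker κ = (x̄, t̄, w̄, z̄′)`, its height, the local dimension -/

/-- `κ` restricted to `B₀` is `x, w ↦ 0`. [plumbing] -/
theorem killMap_algebraMap (h₁ : Polynomial (MvPolynomial (Fin 4) k)) (h₂ : Polynomial (AdjoinRoot h₁))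
    (κ : AdjoinRoot h₂ →+* MvPolynomial (Fin 4) k)
    (hκ : κ.comp (algebraMap (MvPolynomial (Fin 4) k) (AdjoinRoot h₂)) = (aeval (fun i : Fin 4 => if i = 0 ∨ i = 3 then (0 : MvPolynomial (Fin 4) k) else X i)).toRingHom ∧
      κ (AdjoinRoot.of h₂ (AdjoinRoot.root h₁)) = 0 ∧ κ (AdjoinRoot.root h₂) = 0)
    (b : MvPolynomial (Fin 4) k) : κ (algebraMap (MvPolynomial (Fin 4) k) (AdjoinRoot h₂) b) = aeval (fun i : Fin 4 => if i = 0 ∨ i = 3 then (0 : MvPolynomial (Fin 4) k) else X i) b := by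
  have h := RingHom.congr_fun hκ.1 b
  simpa using h

/-- ★ **`ker κ = (x̄, t̄, w̄, z̄′)`** — by the normal form `e = a₀ + a₁t̄ + (b₀ + b₁t̄)z̄′` (`aᵢ, bᵢ ∈ B₀`): `κ(e) = a₀(x ↦ 0, w ↦ 0)`. [folklore] -/
theorem ker_killMap_eq (h₁ : Polynomial (MvPolynomial (Fin 4) k)) (hh₁ : h₁ = Polynomial.X ^ 2 - Polynomial.C (X 0 * X 3))
    (h₂ : Polynomial (AdjoinRoot h₁))
    (hh₂ : h₂ = Polynomial.X ^ 2 + (Polynomial.C (algebraMap (MvPolynomial (Fin 4) k) (AdjoinRoot h₁) (X 0)) * Polynomial.X +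
      Polynomial.C (algebraMap (MvPolynomial (Fin 4) k) (AdjoinRoot h₁) (X 0 * (X 1 ^ 3 + X 2 ^ 3)) +
        AdjoinRoot.root h₁ * algebraMap (MvPolynomial (Fin 4) k) (AdjoinRoot h₁) (X 3 ^ 2))))
    (κ : AdjoinRoot h₂ →+* MvPolynomial (Fin 4) k)
    (hκ : κ.comp (algebraMap (MvPolynomial (Fin 4) k) (AdjoinRoot h₂)) = (aeval (fun i : Fin 4 => if i = 0 ∨ i = 3 then (0 : MvPolynomial (Fin 4) k) else X i)).toRingHom ∧
      κ (AdjoinRoot.of h₂ (AdjoinRoot.root h₁)) = 0 ∧ κ (AdjoinRoot.root h₂) = 0) :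
    RingHom.ker κ = Ideal.span {algebraMap (MvPolynomial (Fin 4) k) (AdjoinRoot h₂) (X 0), AdjoinRoot.of h₂ (AdjoinRoot.root h₁), algebraMap (MvPolynomial (Fin 4) k) (AdjoinRoot h₂) (X 3), AdjoinRoot.root h₂} := by
  have hxI : algebraMap (MvPolynomial (Fin 4) k) (AdjoinRoot h₂) (X 0) ∈ Ideal.span {algebraMap (MvPolynomial (Fin 4) k) (AdjoinRoot h₂) (X 0), AdjoinRoot.of h₂ (AdjoinRoot.root h₁), algebraMap (MvPolynomial (Fin 4) k) (AdjoinRoot h₂) (X 3), AdjoinRoot.root h₂} := Ideal.subset_span (Set.mem_insert _ _)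
  have htI : AdjoinRoot.of h₂ (AdjoinRoot.root h₁) ∈ Ideal.span {algebraMap (MvPolynomial (Fin 4) k) (AdjoinRoot h₂) (X 0), AdjoinRoot.of h₂ (AdjoinRoot.root h₁), algebraMap (MvPolynomial (Fin 4) k) (AdjoinRoot h₂) (X 3), AdjoinRoot.root h₂} := Ideal.subset_span (Set.mem_insert_of_mem _ (Set.mem_insert _ _))
  have hwI : algebraMap (MvPolynomial (Fin 4) k) (AdjoinRoot h₂) (X 3) ∈ Ideal.span {algebraMap (MvPolynomial (Fin 4) k) (AdjoinRoot h₂) (X 0), AdjoinRoot.of h₂ (AdjoinRoot.root h₁), algebraMap (MvPolynomial (Fin 4) k) (AdjoinRoot h₂) (X 3), AdjoinRoot.root h₂} := Ideal.subset_span (Set.mem_insert_of_mem _ (Set.mem_insert_of_mem _ (Set.mem_insert _ _)))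
  have hzI : AdjoinRoot.root h₂ ∈ Ideal.span {algebraMap (MvPolynomial (Fin 4) k) (AdjoinRoot h₂) (X 0), AdjoinRoot.of h₂ (AdjoinRoot.root h₁), algebraMap (MvPolynomial (Fin 4) k) (AdjoinRoot h₂) (X 3), AdjoinRoot.root h₂} := Ideal.subset_span (Set.mem_insert_of_mem _ (Set.mem_insert_of_mem _ (Set.mem_insert_of_mem _ rfl)))
  apply le_antisymm
  · intro e he
    rw [RingHom.mem_ker] at he
    obtain ⟨a, b, rfl⟩ := exists_nf_of_monic_two (monic_h₂ k h₁ h₂ hh₂) (natDegree_h₂_le k h₁ h₂ hh₂) e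
    obtain ⟨a₀, a₁, rfl⟩ := exists_nf_of_monic_two (monic_h₁ k h₁ hh₁) (natDegree_h₁_le k h₁ hh₁) a
    have hκa₀ : aeval (fun i : Fin 4 => if i = 0 ∨ i = 3 then (0 : MvPolynomial (Fin 4) k) else X i) a₀ = 0 := by
      simp only [map_add, map_mul, hκ.2.2, mul_zero, add_zero, hκ.2.1, ← algebraMap_tower_apply, killMap_algebraMap k h₁ h₂ κ hκ] at he
      exact he
    have ha₀ : a₀ ∈ Ideal.span ({X 0, X 3} : Set (MvPolynomial (Fin 4) k)) := by
      rw [← ker_killXW_eq]; exact hκa₀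
    have ha₀' : AdjoinRoot.of h₂ (AdjoinRoot.of h₁ a₀) ∈ Ideal.span {algebraMap (MvPolynomial (Fin 4) k) (AdjoinRoot h₂) (X 0), AdjoinRoot.of h₂ (AdjoinRoot.root h₁), algebraMap (MvPolynomial (Fin 4) k) (AdjoinRoot h₂) (X 3), AdjoinRoot.root h₂} := by
      have h := Ideal.mem_map_of_mem (algebraMap (MvPolynomial (Fin 4) k) (AdjoinRoot h₂)) ha₀
      rw [Ideal.map_span, Set.image_pair, algebraMap_tower_apply] at h
      refine (Ideal.span_le.mpr ?_) h
      rintro r hr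
      rcases hr with rfl | rfl
      · exact hxI
      · exact hwI
    rw [map_add, map_mul]
    exact Ideal.add_mem _ (Ideal.add_mem _ ha₀' (Ideal.mul_mem_left _ _ htI)) (Ideal.mul_mem_left _ _ hzI)
  · rw [Ideal.span_le]
    rintro r hr
    rw [SetLike.mem_coe, RingHom.mem_ker]
    rcases hr with rfl | rfl | rfl | rfl
    · rw [killMap_algebraMap k h₁ h₂ κ hκ, killXW_X]; simp
    · exact hκ.2.1
    · rw [killMap_algebraMap k h₁ h₂ κ hκ, killXW_X]; simp
    · exact hκ.2.2

/-- `ker κ ∩ B₀ = (x, w)`. [plumbing] -/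
theorem under_kerKillMap (h₁ : Polynomial (MvPolynomial (Fin 4) k)) (h₂ : Polynomial (AdjoinRoot h₁))
    (κ : AdjoinRoot h₂ →+* MvPolynomial (Fin 4) k)
    (hκ : κ.comp (algebraMap (MvPolynomial (Fin 4) k) (AdjoinRoot h₂)) = (aeval (fun i : Fin 4 => if i = 0 ∨ i = 3 then (0 : MvPolynomial (Fin 4) k) else X i)).toRingHom ∧
      κ (AdjoinRoot.of h₂ (AdjoinRoot.root h₁)) = 0 ∧ κ (AdjoinRoot.root h₂) = 0) :
    (RingHom.ker κ).under (MvPolynomial (Fin 4) k) = Ideal.span {X 0, X 3} := by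
  rw [Ideal.under_def, RingHom.comap_ker, hκ.1]
  exact ker_killXW_eq k

/-- ★★ **`height (ker κ) = 2`**: `T₂ ⊇ B₀` is finite (INCOMPARABILITY `ht 𝔮 ≤ ht (𝔮 ∩ B₀)`, `FlatIntegralCM.height_le_height_under_of_isIntegral`) and free, hence
flat (GOING-DOWN `ht 𝔮 ≥ ht (𝔮 ∩ B₀)`, Mathlib `Ideal.height_eq_height_add_of_liesOver_of_hasGoingDown`), and `𝔮 ∩ B₀ = (x, w)` has height `2`.
[cite: Matsumura1987, Thm. 9.3 (ii), Thm. 9.5, Thm. 13.5] -/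
theorem height_kerKillMap (h₁ : Polynomial (MvPolynomial (Fin 4) k)) (hh₁ : h₁ = Polynomial.X ^ 2 - Polynomial.C (X 0 * X 3))
    (h₂ : Polynomial (AdjoinRoot h₁))
    (hh₂ : h₂ = Polynomial.X ^ 2 + (Polynomial.C (algebraMap (MvPolynomial (Fin 4) k) (AdjoinRoot h₁) (X 0)) * Polynomial.X +
      Polynomial.C (algebraMap (MvPolynomial (Fin 4) k) (AdjoinRoot h₁) (X 0 * (X 1 ^ 3 + X 2 ^ 3)) +
        AdjoinRoot.root h₁ * algebraMap (MvPolynomial (Fin 4) k) (AdjoinRoot h₁) (X 3 ^ 2))))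
    (κ : AdjoinRoot h₂ →+* MvPolynomial (Fin 4) k)
    (hκ : κ.comp (algebraMap (MvPolynomial (Fin 4) k) (AdjoinRoot h₂)) = (aeval (fun i : Fin 4 => if i = 0 ∨ i = 3 then (0 : MvPolynomial (Fin 4) k) else X i)).toRingHom ∧
      κ (AdjoinRoot.of h₂ (AdjoinRoot.root h₁)) = 0 ∧ κ (AdjoinRoot.root h₂) = 0) :
    (RingHom.ker κ).height = 2 := by
  haveI : (RingHom.ker κ).IsPrime := RingHom.ker_isPrime κ
  obtain ⟨hfree, hfin⟩ := free_finite_tower k h₁ hh₁ h₂ hh₂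
  haveI : Algebra.IsIntegral (MvPolynomial (Fin 4) k) (AdjoinRoot h₂) := Algebra.IsIntegral.of_finite _ _
  have hu := under_kerKillMap k h₁ h₂ κ hκ
  apply le_antisymm
  · have h := FlatIntegralCM.height_le_height_under_of_isIntegral (A := MvPolynomial (Fin 4) k) (RingHom.ker κ)
    rwa [hu, height_span_X0_X3] at h
  · haveI : (Ideal.span ({X 0, X 3} : Set (MvPolynomial (Fin 4) k))).IsPrime := isPrime_span_X0_X3 k
    haveI : (RingHom.ker κ).LiesOver (Ideal.span ({X 0, X 3} : Set (MvPolynomial (Fin 4) k))) := ⟨hu.symm⟩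
    have h := Ideal.height_eq_height_add_of_liesOver_of_hasGoingDown (Ideal.span ({X 0, X 3} : Set (MvPolynomial (Fin 4) k))) (RingHom.ker κ)
    rw [height_span_X0_X3] at h
    rw [h]
    exact le_self_add

/-- ★★ **`dim (T₂)_𝔮 = 2`** at `𝔮 = ker κ = (x̄, t̄, w̄, z̄′)` — the generic point of the non-FULL locus of the chart. [folklore] -/
theorem ringKrullDim_localization_kerKillMap (h₁ : Polynomial (MvPolynomial (Fin 4) k)) (hh₁ : h₁ = Polynomial.X ^ 2 - Polynomial.C (X 0 * X 3))
    (h₂ : Polynomial (AdjoinRoot h₁))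
    (hh₂ : h₂ = Polynomial.X ^ 2 + (Polynomial.C (algebraMap (MvPolynomial (Fin 4) k) (AdjoinRoot h₁) (X 0)) * Polynomial.X +
      Polynomial.C (algebraMap (MvPolynomial (Fin 4) k) (AdjoinRoot h₁) (X 0 * (X 1 ^ 3 + X 2 ^ 3)) +
        AdjoinRoot.root h₁ * algebraMap (MvPolynomial (Fin 4) k) (AdjoinRoot h₁) (X 3 ^ 2))))
    (κ : AdjoinRoot h₂ →+* MvPolynomial (Fin 4) k)
    (hκ : κ.comp (algebraMap (MvPolynomial (Fin 4) k) (AdjoinRoot h₂)) = (aeval (fun i : Fin 4 => if i = 0 ∨ i = 3 then (0 : MvPolynomial (Fin 4) k) else X i)).toRingHom ∧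
      κ (AdjoinRoot.of h₂ (AdjoinRoot.root h₁)) = 0 ∧ κ (AdjoinRoot.root h₂) = 0)
    (Q : Ideal (AdjoinRoot h₂)) [Q.IsPrime] (hQ : Q = RingHom.ker κ) : ringKrullDim (Localization.AtPrime Q) = (2 : ℕ) := by
  rw [IsLocalization.AtPrime.ringKrullDim_eq_height Q (Localization.AtPrime Q)]
  subst hQ
  rw [height_kerKillMap k h₁ hh₁ h₂ hh₂ κ hκ]
  rfl

/-! ## §2 ★★ The local ring `(T₂)_𝔮` is NOT FULL -/

set_option maxHeartbeats 800000 in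
-- one two-level tower lift + one localization lift into `Frac(B₀)[ε₁][ε₂]` and several ideal-membership computations (same budget as p615290's one-ε witness)
/-- ★★ **`¬ FullCl 2 ((T₂)_𝔮)` AT `𝔮 = ker κ = (x̄, t̄, w̄, z̄′)`**: `dim (T₂)_𝔮 = 2`, `s = (x̄, w̄)` is a system of parameters (`√(s) ∋ t̄, z̄′`), `(t̄z̄′)² ∈ (x̄², w̄²)`, but
`t̄z̄′ ∉ (x̄, w̄)(T₂)_𝔮` — witnessed by `(T₂)_𝔮 → F[ε₁][ε₂]` for ANY field `F` receiving `B₀ = k[x, y′, u′, w]` injectively (`x, w ↦ 0`, `t̄ ↦ ε₂`, `z̄′ ↦ ε₁`;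
`t̄z̄′ ↦ ε₂ε₁ ≠ 0`). Over ANY field `k`. (Stated with `F` a parameter: instance search on `F[ε₁][ε₂]` stays cheap.) [OURS · certificate; cite: Fedder1983, Prop. 1.7 (context)] -/
theorem not_fullCl_localization_kerKillMap_of_injective {F : Type} [Field F] (ι : MvPolynomial (Fin 4) k →+* F) (hι : Function.Injective ι)
    (h₁ : Polynomial (MvPolynomial (Fin 4) k)) (hh₁ : h₁ = Polynomial.X ^ 2 - Polynomial.C (X 0 * X 3))
    (h₂ : Polynomial (AdjoinRoot h₁))
    (hh₂ : h₂ = Polynomial.X ^ 2 + (Polynomial.C (algebraMap (MvPolynomial (Fin 4) k) (AdjoinRoot h₁) (X 0)) * Polynomial.X +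
      Polynomial.C (algebraMap (MvPolynomial (Fin 4) k) (AdjoinRoot h₁) (X 0 * (X 1 ^ 3 + X 2 ^ 3)) +
        AdjoinRoot.root h₁ * algebraMap (MvPolynomial (Fin 4) k) (AdjoinRoot h₁) (X 3 ^ 2))))
    (κ : AdjoinRoot h₂ →+* MvPolynomial (Fin 4) k)
    (hκ : κ.comp (algebraMap (MvPolynomial (Fin 4) k) (AdjoinRoot h₂)) = (aeval (fun i : Fin 4 => if i = 0 ∨ i = 3 then (0 : MvPolynomial (Fin 4) k) else X i)).toRingHom ∧
      κ (AdjoinRoot.of h₂ (AdjoinRoot.root h₁)) = 0 ∧ κ (AdjoinRoot.root h₂) = 0)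
    (Q : Ideal (AdjoinRoot h₂)) [Q.IsPrime] (hQ : Q = RingHom.ker κ) : ¬ FullCl 2 (Localization.AtPrime Q) := by
  classical
  intro hfull
  set L := Localization.AtPrime Q with hL
  set alg : AdjoinRoot h₂ →+* L := algebraMap (AdjoinRoot h₂) L with halg
  have hQeq : Q = Ideal.span {algebraMap (MvPolynomial (Fin 4) k) (AdjoinRoot h₂) (X 0), AdjoinRoot.of h₂ (AdjoinRoot.root h₁), algebraMap (MvPolynomial (Fin 4) k) (AdjoinRoot h₂) (X 3), AdjoinRoot.root h₂} := by
    rw [hQ, ker_killMap_eq k h₁ hh₁ h₂ hh₂ κ hκ]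
  have hxQ : algebraMap (MvPolynomial (Fin 4) k) (AdjoinRoot h₂) (X 0) ∈ Q := hQeq ▸ Ideal.subset_span (Set.mem_insert _ _)
  have hwQ : algebraMap (MvPolynomial (Fin 4) k) (AdjoinRoot h₂) (X 3) ∈ Q := hQeq ▸ Ideal.subset_span (Set.mem_insert_of_mem _ (Set.mem_insert_of_mem _ (Set.mem_insert _ _)))
  -- (1) the dimension
  have hdim : ringKrullDim L = (2 : ℕ) := ringKrullDim_localization_kerKillMap k h₁ hh₁ h₂ hh₂ κ hκ Q hQ
  -- (2) the system of parameters `s = (x̄, w̄)` and the relations in `L`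
  let s : Fin 2 → L := ![alg (algebraMap (MvPolynomial (Fin 4) k) (AdjoinRoot h₂) (X 0)), alg (algebraMap (MvPolynomial (Fin 4) k) (AdjoinRoot h₂) (X 3))]
  have hxs : alg (algebraMap (MvPolynomial (Fin 4) k) (AdjoinRoot h₂) (X 0)) ∈ Ideal.span (Set.range s) := Ideal.subset_span ⟨0, rfl⟩
  have hws : alg (algebraMap (MvPolynomial (Fin 4) k) (AdjoinRoot h₂) (X 3)) ∈ Ideal.span (Set.range s) := Ideal.subset_span ⟨1, rfl⟩
  have ht2 : alg (AdjoinRoot.of h₂ (AdjoinRoot.root h₁)) ^ 2 = alg (algebraMap (MvPolynomial (Fin 4) k) (AdjoinRoot h₂) (X 0)) * alg (algebraMap (MvPolynomial (Fin 4) k) (AdjoinRoot h₂) (X 3)) := by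
    rw [← map_pow, t_sq_eq k h₁ hh₁ h₂, map_mul]
  have hz2 : alg (AdjoinRoot.root h₂) ^ 2 = -(alg (algebraMap (MvPolynomial (Fin 4) k) (AdjoinRoot h₂) (X 0)) * alg (AdjoinRoot.root h₂) + alg (algebraMap (MvPolynomial (Fin 4) k) (AdjoinRoot h₂) (X 0)) * (alg (algebraMap (MvPolynomial (Fin 4) k) (AdjoinRoot h₂) (X 1)) ^ 3 + alg (algebraMap (MvPolynomial (Fin 4) k) (AdjoinRoot h₂) (X 2)) ^ 3) +
      alg (AdjoinRoot.of h₂ (AdjoinRoot.root h₁)) * alg (algebraMap (MvPolynomial (Fin 4) k) (AdjoinRoot h₂) (X 3)) ^ 2) := by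
    rw [← map_pow, z_sq_eq k h₁ h₂ hh₂]
    simp only [map_neg, map_add, map_mul, map_pow]
  have ht2mem : alg (AdjoinRoot.of h₂ (AdjoinRoot.root h₁)) ^ 2 ∈ Ideal.span (Set.range s) := by
    rw [ht2]; exact Ideal.mul_mem_left _ _ hws
  have hz2mem : alg (AdjoinRoot.root h₂) ^ 2 ∈ Ideal.span (Set.range s) := by
    rw [hz2]
    exact (Ideal.span (Set.range s)).neg_mem (Ideal.add_mem _ (Ideal.add_mem _ (Ideal.mul_mem_right _ _ hxs) (Ideal.mul_mem_right _ _ hxs))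
      (Ideal.mul_mem_left _ _ (Ideal.pow_mem_of_mem _ hws 2 two_pos)))
  have hmaxL : IsLocalRing.maximalIdeal L = Q.map alg := (Localization.AtPrime.map_eq_maximalIdeal (I := Q)).symm
  have hgen : ∀ r ∈ ({algebraMap (MvPolynomial (Fin 4) k) (AdjoinRoot h₂) (X 0), AdjoinRoot.of h₂ (AdjoinRoot.root h₁), algebraMap (MvPolynomial (Fin 4) k) (AdjoinRoot h₂) (X 3), AdjoinRoot.root h₂} : Set (AdjoinRoot h₂)),
      alg r ∈ (Ideal.span (Set.range s)).radical := by
    intro r hr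
    rcases hr with rfl | rfl | rfl | rfl
    · exact Ideal.le_radical hxs
    · exact ⟨2, ht2mem⟩
    · exact Ideal.le_radical hws
    · exact ⟨2, hz2mem⟩
  have hle : Ideal.span (Set.range s) ≤ IsLocalRing.maximalIdeal L := by
    rw [Ideal.span_le, hmaxL]
    rintro _ ⟨j, rfl⟩
    fin_cases j
    · exact Ideal.mem_map_of_mem alg hxQ
    · exact Ideal.mem_map_of_mem alg hwQ
  have hrad_eq : (Ideal.span (Set.range s)).radical = IsLocalRing.maximalIdeal L := by
    apply le_antisymm
    · exact (Ideal.radical_mono hle).trans_eq (IsLocalRing.maximalIdeal.isMaximal L).isPrime.radical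
    · rw [hmaxL]
      refine Ideal.map_le_iff_le_comap.mpr fun q hq => ?_
      rw [hQeq] at hq
      refine (Ideal.span_le.mpr ?_) hq
      rintro r hr
      exact hgen r hr
  have hrad : (Ideal.span (Set.range s)).radical.IsMaximal := by
    rw [hrad_eq]; exact IsLocalRing.maximalIdeal.isMaximal L
  -- (3) clause 3 of `FullCl 2` at `y = t̄z̄′`, `e = 1`: `(t̄z̄′)² = x̄²·(−w̄(z̄′+ȳ′³+ū′³)) + w̄²·(−x̄t̄w̄)`
  obtain ⟨-, hclause⟩ := hfull
  have hsq : (alg (AdjoinRoot.of h₂ (AdjoinRoot.root h₁)) * alg (AdjoinRoot.root h₂)) ^ 2 ∈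
      Ideal.span ((fun q : L => q ^ 2) '' (Ideal.span (Set.range s) : Set L)) := by
    have e : (alg (AdjoinRoot.of h₂ (AdjoinRoot.root h₁)) * alg (AdjoinRoot.root h₂)) ^ 2 =
        alg (algebraMap (MvPolynomial (Fin 4) k) (AdjoinRoot h₂) (X 0)) ^ 2 * (-(alg (algebraMap (MvPolynomial (Fin 4) k) (AdjoinRoot h₂) (X 3)) * alg (AdjoinRoot.root h₂) + alg (algebraMap (MvPolynomial (Fin 4) k) (AdjoinRoot h₂) (X 3)) * (alg (algebraMap (MvPolynomial (Fin 4) k) (AdjoinRoot h₂) (X 1)) ^ 3 + alg (algebraMap (MvPolynomial (Fin 4) k) (AdjoinRoot h₂) (X 2)) ^ 3))) +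
          alg (algebraMap (MvPolynomial (Fin 4) k) (AdjoinRoot h₂) (X 3)) ^ 2 * (-(alg (algebraMap (MvPolynomial (Fin 4) k) (AdjoinRoot h₂) (X 0)) * alg (AdjoinRoot.of h₂ (AdjoinRoot.root h₁)) * alg (algebraMap (MvPolynomial (Fin 4) k) (AdjoinRoot h₂) (X 3)))) := by
      linear_combination (alg (AdjoinRoot.root h₂) ^ 2) * ht2 + (alg (algebraMap (MvPolynomial (Fin 4) k) (AdjoinRoot h₂) (X 0)) * alg (algebraMap (MvPolynomial (Fin 4) k) (AdjoinRoot h₂) (X 3))) * hz2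
    rw [e]
    exact Ideal.add_mem _ (Ideal.mul_mem_right _ _ (Ideal.subset_span (Set.mem_image_of_mem _ hxs)))
      (Ideal.mul_mem_right _ _ (Ideal.subset_span (Set.mem_image_of_mem _ hws)))
  have hF3 : alg (AdjoinRoot.of h₂ (AdjoinRoot.root h₁)) * alg (AdjoinRoot.root h₂) ∈ Ideal.span (Set.range s) :=
    (hclause 2 hdim s hrad).2 _ ⟨1, by simpa only [pow_one] using hsq⟩
  -- (4) `t̄z̄′ ∉ (x̄, w̄)(T₂)_𝔮`: the two-ε target `F[ε₁][ε₂]` (`F ⊇ B₀` any field, e.g. `Frac B₀`)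
  let g : MvPolynomial (Fin 4) k →+* DualNumber (DualNumber F) :=
    ((TrivSqZeroExt.inlHom (DualNumber F) (DualNumber F)).comp (TrivSqZeroExt.inlHom F F)).comp
      (ι.comp (aeval (fun i : Fin 4 => if i = 0 ∨ i = 3 then (0 : MvPolynomial (Fin 4) k) else X i)).toRingHom)
  have hgapply : ∀ b, g b = TrivSqZeroExt.inl (TrivSqZeroExt.inl (ι (aeval (fun i : Fin 4 => if i = 0 ∨ i = 3 then (0 : MvPolynomial (Fin 4) k) else X i) b))) := fun b => rfl
  have hgx : g (X 0) = 0 := by rw [hgapply, killXW_X]; simp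
  have hgw : g (X 3) = 0 := by rw [hgapply, killXW_X]; simp
  have hz₀sq : (TrivSqZeroExt.inl DualNumber.eps : DualNumber (DualNumber F)) ^ 2 = 0 := by
    change (TrivSqZeroExt.inlHom (DualNumber F) (DualNumber F) DualNumber.eps) ^ 2 = 0
    rw [← map_pow, DualNumber.eps_pow_two, map_zero]
  obtain ⟨φ₁, hφB, hφt, hφz⟩ : ∃ φ₁ : AdjoinRoot h₂ →+* DualNumber (DualNumber F),
      φ₁.comp (algebraMap (MvPolynomial (Fin 4) k) (AdjoinRoot h₂)) = g ∧
        φ₁ (AdjoinRoot.of h₂ (AdjoinRoot.root h₁)) = DualNumber.eps ∧ φ₁ (AdjoinRoot.root h₂) = TrivSqZeroExt.inl DualNumber.eps := by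
    refine exists_towerLift (S := DualNumber (DualNumber F)) k h₁ hh₁ h₂ hh₂ g DualNumber.eps (TrivSqZeroExt.inl DualNumber.eps) ?_ ?_
    · rw [hgx, zero_mul]; exact DualNumber.eps_pow_two
    · rw [hgx, hgw]; linear_combination hz₀sq
  have hφalg : ∀ b, φ₁ (algebraMap (MvPolynomial (Fin 4) k) (AdjoinRoot h₂) b) = g b := fun b => RingHom.congr_fun hφB b
  -- `fst ∘ fst ∘ φ₁ = Frac ∘ κ`
  let π₂ : DualNumber (DualNumber F) →+* DualNumber F :=
    (TrivSqZeroExt.fstHom (DualNumber F) (DualNumber F) (DualNumber F)).toRingHom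
  let π₁ : DualNumber F →+* F := (TrivSqZeroExt.fstHom F F F).toRingHom
  have hπ : ∀ q : DualNumber (DualNumber F), π₁ (π₂ q) = TrivSqZeroExt.fst (TrivSqZeroExt.fst q) := fun q => rfl
  have hfst : (π₁.comp π₂).comp φ₁ = ι.comp κ := by
    refine tower₂_ringHom_ext k h₁ h₂ (RingHom.ext fun b => ?_) ?_ ?_
    · change π₁ (π₂ (φ₁ (algebraMap (MvPolynomial (Fin 4) k) (AdjoinRoot h₂) b))) = ι (κ (algebraMap (MvPolynomial (Fin 4) k) (AdjoinRoot h₂) b))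
      rw [hφalg, killMap_algebraMap k h₁ h₂ κ hκ, hgapply, hπ, TrivSqZeroExt.fst_inl, TrivSqZeroExt.fst_inl]
    · change π₁ (π₂ (φ₁ (AdjoinRoot.of h₂ (AdjoinRoot.root h₁)))) = ι (κ (AdjoinRoot.of h₂ (AdjoinRoot.root h₁)))
      rw [hφt, hκ.2.1, map_zero, hπ, DualNumber.fst_eps, TrivSqZeroExt.fst_zero]
    · change π₁ (π₂ (φ₁ (AdjoinRoot.root h₂))) = ι (κ (AdjoinRoot.root h₂))
      rw [hφz, hκ.2.2, map_zero, hπ, TrivSqZeroExt.fst_inl, DualNumber.fst_eps]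
  have hfst' : ∀ e : AdjoinRoot h₂, TrivSqZeroExt.fst (TrivSqZeroExt.fst (φ₁ e)) = ι (κ e) := fun e => by
    rw [← hπ]; exact RingHom.congr_fun hfst e
  have hunit : ∀ y : Q.primeCompl, IsUnit (φ₁ y) := by
    rintro ⟨y, hy⟩
    change IsUnit (φ₁ y)
    rw [TrivSqZeroExt.isUnit_iff_isUnit_fst, TrivSqZeroExt.isUnit_iff_isUnit_fst, hfst', isUnit_iff_ne_zero]
    intro hc
    apply hy
    have hc' : κ y = 0 := hι (by rw [map_zero]; exact hc)
    change y ∈ Q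
    rw [hQ, RingHom.mem_ker]; exact hc'
  let ψ : L →+* DualNumber (DualNumber F) := IsLocalization.lift (M := Q.primeCompl) (S := L) (P := DualNumber (DualNumber F)) (g := φ₁) hunit
  have hψ : ∀ r : AdjoinRoot h₂, ψ (alg r) = φ₁ r := fun r => IsLocalization.lift_eq (M := Q.primeCompl) (S := L) (P := DualNumber (DualNumber F)) hunit r
  -- `ψ` kills `(s) = (x̄, w̄)` …
  have hψs : ∀ q ∈ Ideal.span (Set.range s), ψ q = 0 := by
    intro q hq
    have hmap : Ideal.span (Set.range s) ≤ RingHom.ker ψ := by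
      rw [Ideal.span_le]
      rintro _ ⟨j, rfl⟩
      rw [SetLike.mem_coe, RingHom.mem_ker]
      fin_cases j
      · change ψ (alg (algebraMap (MvPolynomial (Fin 4) k) (AdjoinRoot h₂) (X 0))) = 0
        rw [hψ, hφalg, hgx]
      · change ψ (alg (algebraMap (MvPolynomial (Fin 4) k) (AdjoinRoot h₂) (X 3))) = 0
        rw [hψ, hφalg, hgw]
    exact hmap hq
  -- … but `t̄z̄′ ↦ ε₂·ε₁ ≠ 0`
  have h0 := hψs _ hF3
  rw [map_mul, hψ, hψ, hφt, hφz] at h0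
  have h1 := congrArg (fun q : DualNumber (DualNumber F) => TrivSqZeroExt.snd (TrivSqZeroExt.snd q)) h0
  simp [TrivSqZeroExt.snd_mul] at h1

/-- ★★ **`¬ FullCl 2 ((T₂)_𝔮)` AT `𝔮 = ker κ = (x̄, t̄, w̄, z̄′)`** (the F-clause fails for the system of parameters `(x̄, w̄)`; target field `F = Frac B₀`). Over ANY field `k`.
[OURS · certificate; cite: Fedder1983, Prop. 1.7 (context)] -/
theorem not_fullCl_localization_kerKillMap (h₁ : Polynomial (MvPolynomial (Fin 4) k)) (hh₁ : h₁ = Polynomial.X ^ 2 - Polynomial.C (X 0 * X 3))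
    (h₂ : Polynomial (AdjoinRoot h₁))
    (hh₂ : h₂ = Polynomial.X ^ 2 + (Polynomial.C (algebraMap (MvPolynomial (Fin 4) k) (AdjoinRoot h₁) (X 0)) * Polynomial.X +
      Polynomial.C (algebraMap (MvPolynomial (Fin 4) k) (AdjoinRoot h₁) (X 0 * (X 1 ^ 3 + X 2 ^ 3)) +
        AdjoinRoot.root h₁ * algebraMap (MvPolynomial (Fin 4) k) (AdjoinRoot h₁) (X 3 ^ 2))))
    (κ : AdjoinRoot h₂ →+* MvPolynomial (Fin 4) k)
    (hκ : κ.comp (algebraMap (MvPolynomial (Fin 4) k) (AdjoinRoot h₂)) = (aeval (fun i : Fin 4 => if i = 0 ∨ i = 3 then (0 : MvPolynomial (Fin 4) k) else X i)).toRingHom ∧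
      κ (AdjoinRoot.of h₂ (AdjoinRoot.root h₁)) = 0 ∧ κ (AdjoinRoot.root h₂) = 0)
    (Q : Ideal (AdjoinRoot h₂)) [Q.IsPrime] (hQ : Q = RingHom.ker κ) : ¬ FullCl 2 (Localization.AtPrime Q) :=
  not_fullCl_localization_kerKillMap_of_injective k (algebraMap (MvPolynomial (Fin 4) k) (FractionRing (MvPolynomial (Fin 4) k)))
    (IsFractionRing.injective (MvPolynomial (Fin 4) k) (FractionRing (MvPolynomial (Fin 4) k))) h₁ hh₁ h₂ hh₂ κ hκ Q hQ

/-! ## §3 ★★ Every point of `V(x̄, t̄, w̄, z̄′) ⊂ Spec T₂` is a NON-FULL point -/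

/-- ★★ **FLOOR 1 OF ROW #3 (P2d4B, `τ = (x̄, ȳ, ū, t̄², z̄)`) IS NON-FULL AT EVERY POINT OF THE 2-DIMENSIONAL LOCUS `V(x̄, t̄, w̄, z̄′)` of the `D(x̄)` chart `Spec T₂`**
(closed or not, rational or not): FULL descends to generizations (`ClauseLocalizes.fiClause_of_specializes`) and the generic point `𝔮` of the locus is not FULL
(§2). The scheme-level identification of `Spec T₂` with the chart of `Bl_τ X` is not claimed here. [OURS · certificate; cite: Fedder1983, Prop. 1.7 (context)] -/
theorem not_fullCl_stalk_of_mem [CharP k 2] (h₁ : Polynomial (MvPolynomial (Fin 4) k)) (hh₁ : h₁ = Polynomial.X ^ 2 - Polynomial.C (X 0 * X 3))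
    (h₂ : Polynomial (AdjoinRoot h₁))
    (hh₂ : h₂ = Polynomial.X ^ 2 + (Polynomial.C (algebraMap (MvPolynomial (Fin 4) k) (AdjoinRoot h₁) (X 0)) * Polynomial.X +
      Polynomial.C (algebraMap (MvPolynomial (Fin 4) k) (AdjoinRoot h₁) (X 0 * (X 1 ^ 3 + X 2 ^ 3)) +
        AdjoinRoot.root h₁ * algebraMap (MvPolynomial (Fin 4) k) (AdjoinRoot h₁) (X 3 ^ 2))))
    (κ : AdjoinRoot h₂ →+* MvPolynomial (Fin 4) k)
    (hκ : κ.comp (algebraMap (MvPolynomial (Fin 4) k) (AdjoinRoot h₂)) = (aeval (fun i : Fin 4 => if i = 0 ∨ i = 3 then (0 : MvPolynomial (Fin 4) k) else X i)).toRingHom ∧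
      κ (AdjoinRoot.of h₂ (AdjoinRoot.root h₁)) = 0 ∧ κ (AdjoinRoot.root h₂) = 0)
    (w : Spec (.of (AdjoinRoot h₂))) (hxw : algebraMap (MvPolynomial (Fin 4) k) (AdjoinRoot h₂) (X 0) ∈ w.asIdeal) (htw : AdjoinRoot.of h₂ (AdjoinRoot.root h₁) ∈ w.asIdeal)
    (hww : algebraMap (MvPolynomial (Fin 4) k) (AdjoinRoot h₂) (X 3) ∈ w.asIdeal) (hzw : AdjoinRoot.root h₂ ∈ w.asIdeal) :
    ¬ FullCl 2 ((Spec (.of (AdjoinRoot h₂))).presheaf.stalk w) := by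
  haveI : Fact (Nat.Prime 2) := ⟨Nat.prime_two⟩
  haveI h𝔮 : (RingHom.ker κ).IsPrime := RingHom.ker_isPrime κ
  intro hfw
  -- the generic point `η = 𝔮` of `V(x̄, t̄, w̄, z̄′)` specialises to `w`
  let η : Spec (.of (AdjoinRoot h₂)) := ⟨RingHom.ker κ, h𝔮⟩
  have hle : η.asIdeal ≤ w.asIdeal := by
    change RingHom.ker κ ≤ w.asIdeal
    rw [ker_killMap_eq k h₁ hh₁ h₂ hh₂ κ hκ, Ideal.span_le]
    rintro r hr
    rcases hr with rfl | rfl | rfl | rfl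
    · exact hxw
    · exact htw
    · exact hww
    · exact hzw
  have hηw : η ⤳ w := (PrimeSpectrum.le_iff_specializes _ _).mp ((PrimeSpectrum.asIdeal_le_asIdeal _ _).mp hle)
  haveI : CharP ((Spec (.of (AdjoinRoot h₂))).presheaf.stalk w) 2 :=
    FTemkinClosedPoints.charP_stalk_of_over 2 (Spec.map (CommRingCat.ofHom (algebraMap k (AdjoinRoot h₂)))) (𝟙 _) w
  have hη := ClauseLocalizes.fiClause_of_specializes 2 hηw hfw
  -- the stalk at `η` is `(T₂)_𝔮`
  have hLη : FullCl 2 (Localization.AtPrime η.asIdeal) :=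
    WFixAtNonClosedDimTwo.fullCl_of_ringEquiv 2 (Spec.stalkIso (.of _) η).commRingCatIsoToRingEquiv hη
  exact not_fullCl_localization_kerKillMap k h₁ hh₁ h₂ hh₂ κ hκ η.asIdeal rfl hLη

end Summit.ResolutionOfSingularities.ResolutionOfSingularities.Theorems.FInjectiveMacaulayfication.TauFloorBXChartNotFull

end
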